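import Mathlib
import HarnessLib
import Summits.HubbardSuperconductivity.HubbardSuperconductivity.Theses.KLProgramme
import Summits.HubbardSuperconductivity.HubbardSuperconductivity.Theorems.KLProgrammeKLRegimeBetaSplitV16

/-!
# Route `KLProgramme` — crux K3 gen 6, child 1 `KLRegimeBetaSplitV16 := BetaSplitP klPredsV16 klWindowC`, CLOSED by `KLRegimeSplit.betaSplitP_klPredsV16`
# (`…BetaSplitV16`, p2 g9 p508361, via k3c2-p3's `betaSplitP_of_slotsV10S`).  Proof only; nothing here asserts superconductivity.
-/

noncomputable section

namespace Summit.HubbardSuperconductivity.HubbardSuperconductivity.Theorems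

set_option linter.dupNamespace false -- summit = problem name (single-conjunct summit), D-0017

/-- **Child 1 of the gen-6 split of K3, by name**: `KLRegimeBetaSplitV16`. -/
theorem klRegimeBetaSplitV16_proof : Summit.HubbardSuperconductivity.HubbardSuperconductivity.Theses.KLProgramme.KLRegimeBetaSplitV16 :=
  KLRegimeSplit.betaSplitP_klPredsV16 KLRegimeSplit.klWindowC

end Summit.HubbardSuperconductivity.HubbardSuperconductivity.Theorems

end
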